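import Mathlib
import HarnessLib
import Summits.HubbardSuperconductivity.HubbardSuperconductivity.Theorems.KLProgrammeKLRegimeTwoVolumeProfileBridge
import Summits.HubbardSuperconductivity.HubbardSuperconductivity.Theorems.KLProgrammeKLRegimeTwoVolumeGridBlockStep
import Summits.HubbardSuperconductivity.HubbardSuperconductivity.Theorems.KLProgrammeKLRegimeEngineScaleZeroE4GridVertex
import Literature.MathematicalPhysics.QuantumLattice.GrassmannWeightedEffectiveActionBoundDB

/-!
# The `(1 + diam)`-weighted pinned profile of a grid effective action from ONE-VOLUME covariance data (β′ two-volume pass, input `Nw` / `Nw₁`)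

The block step `hubbardGrid_sum_norm_kernel_sub_le_response` (coarse profile `Nw`) and the read-out door `abs_klLocalPart_flowFrame_zero_sub_le`
(fine degree-`2` profile `Nw₁`) both ask for the pinned `L¹` kernel profile of `effAction G (V_N + 𝒩_{K,N})` weighted by `1 + diam` in the torus
distance `tnorm` of the leg sites.  This file produces it, at ANY grid covariance `G` on the grid legs, from: the replica-Gram property
`IsGramBoundedR G κ`, the `(1 + tnorm)`-weighted row / column sums `≤ αw` of `G`, and the smallness `θ = e·αw·‖𝒱‖_{h,wt}/κ² < 1`, via the
decay-weighted determinant-bounded single-scale step `sum_wt_norm_kernel_effAction_le_of_gramBounded` with the tree weight `(1 + 1·diam)^1`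
of `isLabelDist_tnorm_site`, and the grid vertex profile `sum_norm_kernel_gridVertex_mul_wt_le` read at time weight `β′ = 0` (then
`gridLabelWt L Ng 0 = 1 + diam_{torusSiteDist}` dominates the `tnorm` weight: `one_add_labelDiam_tnorm_le_gridLabelWt`).  It also returns the
grid partition function as a unit (the `hZ` inputs of both doors).
-/

noncomputable section

namespace Summit.HubbardSuperconductivity.HubbardSuperconductivity.Theorems.TwoVolumeDefect

open Finset Literature.MathematicalPhysics.QuantumLattice GrassmannAlgebra Literature.Probability.LatticeModels
  Literature.Probability.LatticeModels.BattleFederbush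
open Summit.HubbardSuperconductivity.HubbardSuperconductivity.Theorems.EngineV8
open scoped Nat

variable {L Ng : ℕ} [NeZero L] [NeZero Ng]

/-- **THE WEIGHTED PINNED PROFILE OF A GRID EFFECTIVE ACTION FROM ONE-VOLUME DATA.**  For a grid covariance `G` with `IsGramBoundedR G κ` and
`(1 + tnorm)`-weighted row/column sums `≤ αw`, the grid interaction `V = hubbardGridInteraction L Ng β U + hubbardGridCounterQuadratic L Ng β K`
(vertex profile `Nv 1 = (|β|/Ng)·Σ_z ‖Ǩ(z)‖(1+|z|)`, `Nv 2 = |U||β|/Ng`), a weight `ρ > 0` and `θ = e·αw·normV(κ, ρ, Nv)/κ² < 1`: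
the grid partition function is a unit and, for every `m′`, pinned leg `j` and label `x`,
`Σ_{Y : Y j = x} ‖kernel (effAction G V) (2m′) Y‖·(1 + diam_{tnorm}(Y)) ≤ ρ^{-2m′}·e·normV(κ, ρ, Nv)/(1 − θ)`. -/
theorem isUnit_and_weightedProfile_of_gridData (G : Matrix (GridLeg (GridPoint L Ng)) (GridLeg (GridPoint L Ng)) ℂ) {κ : ℝ} (hκ : 0 < κ)
    (hGB : IsGramBoundedR G κ) (β U : ℝ) (K : TrigPolyC4v) {αw : ℝ} (hαw : 0 < αw)
    (hrow : ∀ X, ∑ Y, ‖G X Y‖ * (1 + (Torus.tnorm (X.1.1.2 - Y.1.1.2) : ℝ)) ≤ αw)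
    (hcol : ∀ Y, ∑ X, ‖G X Y‖ * (1 + (Torus.tnorm (X.1.1.2 - Y.1.1.2) : ℝ)) ≤ αw)
    {ρ : ℝ} (hρ : 0 < ρ)
    (hθ : Real.exp 1 * αw * normV (GridLeg (GridPoint L Ng)) κ ρ
      (fun m' : ℕ => if m' = 1 then |β| / Ng * ∑ z : TorusSite 2 L, ‖framePosKernel L K z‖ * (1 + torusSiteDist z 0)
        else if m' = 2 then |U| * |β| / Ng else 0) / κ ^ 2 < 1) :
    IsUnit (effPartitionFn ℂ G (hubbardGridInteraction L Ng β U + hubbardGridCounterQuadratic L Ng β K)) ∧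
      ∀ (m' : ℕ) (j : Fin (2 * m')) (x : GridLeg (GridPoint L Ng)),
        ∑ Y ∈ univ.filter (fun Y : Fin (2 * m') → GridLeg (GridPoint L Ng) => Y j = x),
          ‖kernel ℂ (effAction ℂ G (hubbardGridInteraction L Ng β U + hubbardGridCounterQuadratic L Ng β K)) (2 * m') Y‖ *
            (1 + labelDiam (fun Y₁ Y₂ : GridLeg (GridPoint L Ng) => (Torus.tnorm (Y₁.1.1.2 - Y₂.1.1.2) : ℝ)) (univ.image Y)) ≤
          ρ⁻¹ ^ (2 * m') * (Real.exp 1 * normV (GridLeg (GridPoint L Ng)) κ ρ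
            (fun m' : ℕ => if m' = 1 then |β| / Ng * ∑ z : TorusSite 2 L, ‖framePosKernel L K z‖ * (1 + torusSiteDist z 0)
              else if m' = 2 then |U| * |β| / Ng else 0)) /
            (1 - Real.exp 1 * αw * normV (GridLeg (GridPoint L Ng)) κ ρ
              (fun m' : ℕ => if m' = 1 then |β| / Ng * ∑ z : TorusSite 2 L, ‖framePosKernel L K z‖ * (1 + torusSiteDist z 0)
                else if m' = 2 then |U| * |β| / Ng else 0) / κ ^ 2) := by
  classical
  -- notation
  set dtn : GridLeg (GridPoint L Ng) → GridLeg (GridPoint L Ng) → ℝ := fun Y₁ Y₂ => (Torus.tnorm (Y₁.1.1.2 - Y₂.1.1.2) : ℝ) with hdtn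
  have hdc : IsLabelDist dtn := isLabelDist_tnorm_site
  set V : GrassmannAlgebra ℂ (GridLeg (GridPoint L Ng)) := hubbardGridInteraction L Ng β U + hubbardGridCounterQuadratic L Ng β K with hV
  set Nv : ℕ → ℝ := fun m' : ℕ => if m' = 1 then |β| / Ng * ∑ z : TorusSite 2 L, ‖framePosKernel L K z‖ * (1 + torusSiteDist z 0)
    else if m' = 2 then |U| * |β| / Ng else 0 with hNv
  -- the tree weight `1 + diam`
  set wt : Finset (GridLeg (GridPoint L Ng)) → ℝ := diamWeight (fun t => (1 + (1 : ℝ) * t) ^ 1) dtn with hwt_def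
  have hwt : IsTreeWeight wt := isTreeWeight_polyDiamWeight hdc zero_le_one 1
  have hwt_apply : ∀ S, wt S = 1 + labelDiam dtn S := fun S => by
    simp only [hwt_def, diamWeight, one_mul, pow_one]
  have hpair : ∀ X Y : GridLeg (GridPoint L Ng), wt {X, Y} = 1 + dtn X Y := fun X Y => by
    rw [hwt_def, diamWeight_pair hdc, one_mul, pow_one]
  -- the vertex: parity, constant part, weighted profile (read at time weight `β′ = 0`, where `gridLabelWt = 1 + diam_{torusSiteDist}`)
  have hVe : V ∈ evenPart ℂ (GridLeg (GridPoint L Ng)) :=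
    add_mem (hubbardGridInteraction_mem_evenPart β U) (hubbardGridCounterQuadratic_mem_evenPart β K)
  have hV0 : constPart ℂ V = 0 := by
    rw [hV, map_add, constPart_hubbardGridInteraction, constPart_hubbardGridCounterQuadratic, add_zero]
  have hNv0 : ∀ m', 0 ≤ Nv m' := fun m' => by
    simp only [hNv]
    split_ifs
    · exact mul_nonneg (by positivity) (sum_nonneg fun z _ => mul_nonneg (norm_nonneg _)
        (by have := (isLabelDist_torusSiteDist (d := 2) (L := L)).nonneg z 0; linarith))
    · positivity
    · exact le_rfl
  have hN : ∀ (m' : ℕ) (j : Fin (2 * m')) (w : GridLeg (GridPoint L Ng)),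
      ∑ Y ∈ univ.filter (fun Y : Fin (2 * m') → GridLeg (GridPoint L Ng) => Y j = w), ‖kernel ℂ V (2 * m') Y‖ * wt (univ.image Y) ≤ Nv m' := by
    intro m' j w
    refine le_trans (sum_le_sum fun Y _ => ?_) (sum_norm_kernel_gridVertex_mul_wt_le (L := L) (Ng := Ng) β U le_rfl K m' j w)
    rw [hwt_apply]
    exact mul_le_mul_of_nonneg_left (one_add_labelDiam_tnorm_le_gridLabelWt le_rfl _) (norm_nonneg _)
  -- weighted rows / columns in the pair weight
  have hrow' : ∀ X, ∑ Y, ‖G X Y‖ * wt {X, Y} ≤ αw := fun X => by simp only [hpair]; exact hrow X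
  have hcol' : ∀ Y, ∑ X, ‖G X Y‖ * wt {X, Y} ≤ αw := fun Y => by simp only [hpair]; exact hcol Y
  -- the decay-weighted single-scale step
  obtain ⟨hZ, hstep⟩ := sum_wt_norm_kernel_effAction_le_of_gramBounded G hwt hκ hGB V hVe hV0 Nv hNv0 hN hαw hrow' hcol' hρ hθ
  refine ⟨hZ, fun m' j x => ?_⟩
  rcases Nat.eq_zero_or_pos m' with hm | hm
  · subst hm; exact absurd j.2 (by omega)
  have h := hstep (m := 2 * m') (by omega) j x
  refine le_trans (le_of_eq (sum_congr rfl fun Y _ => ?_)) h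
  rw [hwt_apply, mul_comm]

end Summit.HubbardSuperconductivity.HubbardSuperconductivity.Theorems.TwoVolumeDefect

end
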